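import Summits.BirchSwinnertonDyer.Rank1Residual.X4.KuriharaClasswide
import Summits.BirchSwinnertonDyer.Rank1Residual.Additive.X4RankZeroUpperBound
import Literature.NumberTheory.EllipticCurves.Kim2026.ShaLengthRankZeroLowerBound
import Literature.NumberTheory.EllipticCurves.KuriharaNumberInvariants
import HarnessLib

/-!
# Kim's Conjecture 1.10 — the TAMAGAWA DEFECT `∂^{(∞)}(δ̃) = ∑_{ℓ ∣ N} ord_p c_ℓ` of the collection
# of Kurihara numbers — TYPED, and its analytic-rank-`0` consumers at `p ≥ 5` from PUBLISHED facts
# (cell `b2b-bsdres`, team n1011, OWNERS row T-N10C)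

HONEST FRAMING (cell `b2b-bsdres`, run/shared/lean/b2b/bsd-rank1-residual/, verbatim in every
file): the goal of the cell is to DELETE the COMBINATION-SHAPED residual classes of the
Birch–Swinnerton-Dyer formula for ALL analytic-rank `≤ 1` elliptic curves over `ℚ` — "full BSD
formula for every rank `≤ 1` curve in class `C`" assembled STRICTLY from published theorems — so
that the rank-`≤ 1` remainder becomes exactly the CONSTRUCTION-SHAPED classes, which are TYPED
(missing-input `Prop`s), NOT attempted. This is not "finishing BSD". Team n1011 (RESIDUAL-MAP §I
N10 / N11), seat `b2b-bsdres-n1011-p12`, OWNERS row T-N10C: research route on the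
CONSTRUCTION-SHAPED class X4; the label X4 and the marks of §I N10 / N11 are UNCHANGED by this file;
nothing is booked; NO Literature fact is minted here (three CONJECTURE items = typed missing inputs,
`@[conjecture] def`, nothing asserted; the rest are theorems composing PUBLISHED named facts of the
tree, each an explicit hypothesis binder).

## What is typed, and why it is THE residue

C.-H. Kim, Amer. J. Math. 148 (2026) 79–129 = arXiv:2203.12159v4, **Conjecture 1.10** (§1.5.3,
PDF p. 8; journal Conj. 1.9), verbatim: *"Let `E` be an elliptic curve over `ℚ` of conductor `N` and
`p ≥ 5` a prime such that `ρ̄` is surjective and the Manin constant is prime to `p`. Then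
`∂^{(∞)}(δ̃) = ∑_{ℓ ∣ N} ord_p(c_ℓ)` where `c_ℓ` is the Tamagawa factor of `E` at `ℓ`."* (= Kim,
arXiv:2505.09121 Conj. 7.4/7.5, PREPRINT, orientation only.) `∂^{(∞)}(δ̃)` is the tree's
`kuriharaPartialInfty W p f` (`KuriharaNumberInvariants.lean`, cc-typer-1: infimum over the CYCLIC
Kolyvagin levels of the `p`-divisibility index of `δ̃_n` in `ℤ_p/I_nℤ_p`) and
`∑_{ℓ ∣ N} ord_p(c_ℓ) = padicValNat p W.tamagawaProduct` (product over ALL finite places, `c_v = 1` at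
good `v`). Typed: `X4.KimTamagawaDefectAt W p f : kuriharaPartialInfty W p f = padicValNat p
W.tamagawaProduct`, its halves `…LeAt` / `…GeAt` (all `@[conjecture] def`, parameter shape of
additive-p3's `X4.KuriharaUnitAt W p f` = the case `∑ ord_p c_ℓ = 0`), and the printed sentence
`X4.kim2026_conjecture_1_10` (hypotheses `p ≥ 5`, `ρ̄` onto, Manin datum `D` with `p ∤ c_D`, plus the
tree's period-transfer clause `Ω(W) = u·Ω⁺_{D.f}`, `|u|_p = 1`, under which the tree's
`Ω⁺_f`-normalised Kurihara numbers are Kim's up to units).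

WHY this is the residue of record (CLASS-CLOSURE-PLAN §3.1 E2 (c) / §3.2; additive-p4's
CLASS-CLOSURE-INPUT §1.1 "IRREDUCIBLE NEW SUB-CASE", §6 (h5)). In analytic rank `0` Kim's clause (6)
(PUBLISHED, `p ≥ 5`, any reduction) reads `length Ш[p^∞] = ∂^{(0)}(δ̃) − ∂^{(∞)}(δ̃)` with
`∂^{(0)} = ord_p(L(E,1)/Ω_E) = ord_p #Ш_an + ∑_ℓ ord_p c_ℓ` (torsion prime to `p`). So on X4 ∧
`r_an = 0` ∧ surj ∧ `p ≥ 5` ∧ Manin: the **`≤` half** is EXACTLY what gives the LOWER half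
`Typed.MissingLowerBoundAt W p` — `missingLowerBoundAt_of_kimTamagawaDefectLe`, from the PUBLISHED
fact `Kim2026.rankZero_le_padicValNat_sha_of_kuriharaNumber_ne_zero` (seat n1011-p11) applied at
the ONE Kolyvagin level the `≤` half produces (§0); on `p ∤ ∏ c_ℓ` rows this is additive-p3's unit
route (`X4/KuriharaClasswide.lean`), on `p ∣ ∏ c_ℓ` rows (N10's LOWER ∧ TAM rows, where NO unit
Kurihara number exists) it is the input those rows lacked a NAME for. The **`≥` half** is what the
TAM-DEFECT₂♭ rows lack (with (6): `ord_p #Ш ≤ ord_p #Ш_an` WITHOUT `p ∤ ∏ c_ℓ`; Büyükboduk 2009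
Question 1); its consumer needs clause (6) read with `∂^{(∞)}` (cc-typer-1's T1) and is NOT here.
OPEN (Kim §1.2.6: "the exact bound of the Tamagawa factors is missing"); at good ordinary `p` a
consequence of the IMC (Kim 2025 §7); at an ADDITIVE `p` no proof in print. `p = 3`: every consumer
below carries `5 ≤ p` (the PUBLISHED facts do); the `p = 3` twins belong to rows T-a2 / T-a4 — and at
`p = 3` Kim 2025's `∑_{ℓ ≠ p}` differs from Kim 2026's `∑_{ℓ ∣ N}` exactly on the Kodaira IV / IV*
rows (`3 ∣ c_3`; Kim Rem. 3.8), while at additive `p ≥ 5`, `c_p ≤ 4` is a `p`-adic unit.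

Contents: §0 ℕ∞-bookkeeping (a finite `∂^{(∞)}` is witnessed by ONE non-zero Kurihara number at ONE
cyclic level; `KuriharaUnitAt ↔ ∂^{(∞)} = 0`); §1 the conjecture items; §2 rank-`0` consumers, `p ≥ 5`.

References: Kim 2026 [Kim2022StructureSelmer] §1.2.6, §1.5.1–1.5.3, Thm. 1.9 (6), Conj. 1.10;
Mazur–Rubin 2004 §5.2 [MazurRubin2004]; Miller 2011 Def. 1.1 [Miller2011LMS]; Büyükboduk JNT 2009.
-/

noncomputable section

open scoped Classical MatrixGroups ModularForm

open CongruenceSubgroup WeierstrassCurve Literature.NumberTheory.EllipticCurves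
  Literature.NumberTheory.EllipticCurves.ModularForms
  Literature.NumberTheory.EllipticCurves.Rank1Residual
  Literature.NumberTheory.EllipticCurves.Rank1Residual.Typed

namespace Summit.BirchSwinnertonDyer.Rank1Residual.X4

/-! ### §0 ℕ∞-bookkeeping: finite invariants are witnessed by ONE non-zero Kurihara number -/

section Bookkeeping

variable (W : WeierstrassCurve ℚ) [W.IsGloballyMinimal] (p : ℕ) {N : ℕ} (f : CuspForm (Gamma0 N) 2)

/-- **Failure of divisibility by `p^j` is witnessed**: if `δ̃_n ∉ p^j ℤ_p/I_nℤ_p`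
(`¬ KuriharaDivisibleAt W p f n j`) then for some `1 ≤ k ≤ j` with `n ∈ 𝒩_k` and some surjective
discrete logarithms `ψ`, `kuriharaNumber f (p^k) n ψ ≠ 0` (`k = 0` is excluded because `ℤ/p^0 = 0`).
Unfolding of cc-typer-1's definition. [cite: Kim2022StructureSelmer, §1.4.3 and §1.5.1 (PDF p. 7)] -/
theorem exists_kuriharaNumber_ne_zero_of_not_divisibleAt {n j : ℕ}
    (h : ¬ KuriharaDivisibleAt W p f n j) :
    ∃ (k : ℕ) (hk : Kato.IsKolyvaginProduct W p k n), 1 ≤ k ∧ k ≤ j ∧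
      ∃ ψ : (ℓ : ℕ) → (ZMod ℓ)ˣ →* Multiplicative (ZMod (p ^ k)),
        (∀ ℓ ∈ n.primeFactors, Function.Surjective (ψ ℓ)) ∧
        (haveI : NeZero n := ⟨hk.ne_zero⟩; kuriharaNumber f (p ^ k) n ψ ≠ 0) := by
  unfold KuriharaDivisibleAt at h
  push Not at h
  obtain ⟨k, hkj, hk, ψ, hψ, hne⟩ := h
  refine ⟨k, hk, ?_, hkj, ψ, hψ, hne⟩
  rcases Nat.eq_zero_or_pos k with rfl | hpos
  · exfalso
    haveI : NeZero n := ⟨hk.ne_zero⟩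
    haveI : Subsingleton (ZMod (p ^ 0)) := ZMod.subsingleton_iff.mpr (pow_zero p)
    exact hne (Subsingleton.elim _ _)
  · exact hpos

/-- **A finite divisibility index is witnessed**: if `kuriharaDivIndex W p f n ≤ τ` (`τ : ℕ`) then
`δ̃_n ∉ p^{τ+1} ℤ_p/I_nℤ_p`, hence a non-zero Kurihara number modulo `p^k` at the level `n` for some
`1 ≤ k ≤ τ + 1` with `n ∈ 𝒩_k`. [cite: Kim2022StructureSelmer, §1.5.1 (PDF p. 7), Def. 2.13 (PDF p. 14)] -/
theorem exists_kuriharaNumber_ne_zero_of_kuriharaDivIndex_le {n τ : ℕ}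
    (h : kuriharaDivIndex W p f n ≤ τ) :
    ∃ (k : ℕ) (hk : Kato.IsKolyvaginProduct W p k n), 1 ≤ k ∧ k ≤ τ + 1 ∧
      ∃ ψ : (ℓ : ℕ) → (ZMod ℓ)ˣ →* Multiplicative (ZMod (p ^ k)),
        (∀ ℓ ∈ n.primeFactors, Function.Surjective (ψ ℓ)) ∧
        (haveI : NeZero n := ⟨hk.ne_zero⟩; kuriharaNumber f (p ^ k) n ψ ≠ 0) := by
  apply exists_kuriharaNumber_ne_zero_of_not_divisibleAt
  intro hdiv
  have := (le_kuriharaDivIndex_of_divisibleAt W p f hdiv).trans h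
  have : τ + 1 ≤ τ := by exact_mod_cast this
  omega

/-- **`∂^{(∞)}(δ̃) ≤ τ` is attained at ONE cyclic level**: there is a cyclic Kolyvagin level `n`
with `kuriharaDivIndex W p f n ≤ τ` (infima in `ℕ∞` over the index sets of `∂^{(i)}`, `∂^{(∞)}`).
[cite: Kim2022StructureSelmer, §1.5.1 (PDF p. 7)] -/
theorem exists_level_of_kuriharaPartialInfty_le {τ : ℕ} (h : kuriharaPartialInfty W p f ≤ τ) :
    ∃ n : ℕ, IsCyclicKolyvaginLevel W p n ∧ kuriharaDivIndex W p f n ≤ τ := by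
  have hlt : kuriharaPartialInfty W p f < ((τ + 1 : ℕ) : ℕ∞) :=
    lt_of_le_of_lt h (by exact_mod_cast Nat.lt_succ_self τ)
  unfold kuriharaPartialInfty at hlt
  obtain ⟨i, hi⟩ := iInf_lt_iff.mp hlt
  rw [kuriharaPartial_def] at hi
  obtain ⟨n, hn⟩ := iInf_lt_iff.mp hi
  obtain ⟨hcyc, hn'⟩ := iInf_lt_iff.mp hn
  obtain ⟨_, hlt'⟩ := iInf_lt_iff.mp hn'
  refine ⟨n, hcyc, ?_⟩
  exact Order.le_of_lt_succ (by simpa [Nat.cast_succ] using hlt')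

/-- **The certificate behind `∂^{(∞)}(δ̃) ≤ τ`**: a cyclic Kolyvagin level `n ∈ 𝒩_k`, `1 ≤ k ≤ τ + 1`,
surjective discrete logarithms `ψ`, and `kuriharaNumber f (p^k) n ψ ≠ 0` — exactly the hypothesis
shape of the tree's Kim-type facts. [cite: Kim2022StructureSelmer, §1.5.1 (PDF p. 7)] -/
theorem exists_certificate_of_kuriharaPartialInfty_le {τ : ℕ} (h : kuriharaPartialInfty W p f ≤ τ) :
    ∃ (n k : ℕ) (hk : Kato.IsKolyvaginProduct W p k n), IsCyclicKolyvaginLevel W p n ∧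
      1 ≤ k ∧ k ≤ τ + 1 ∧
      ∃ ψ : (ℓ : ℕ) → (ZMod ℓ)ˣ →* Multiplicative (ZMod (p ^ k)),
        (∀ ℓ ∈ n.primeFactors, Function.Surjective (ψ ℓ)) ∧
        (haveI : NeZero n := ⟨hk.ne_zero⟩; kuriharaNumber f (p ^ k) n ψ ≠ 0) := by
  obtain ⟨n, hcyc, hle⟩ := exists_level_of_kuriharaPartialInfty_le W p f h
  obtain ⟨k, hk, h1, hkτ, ψ, hψ, hne⟩ :=
    exists_kuriharaNumber_ne_zero_of_kuriharaDivIndex_le W p f hle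
  exact ⟨n, k, hk, hcyc, h1, hkτ, ψ, hψ, hne⟩

/-- **additive-p3's typed input `KuriharaUnitAt` is the case `∂^{(∞)}(δ̃) = 0`**: a unit Kurihara
number at a cyclic level forces `∂^{(∞)} = 0` (`kuriharaPartialInfty_eq_zero_of_ne_zero`), and
conversely `∂^{(∞)} = 0` is witnessed at a cyclic level `n ∈ 𝒩_1` by a unit mod-`p` Kurihara number
(the certificate with `k = 1`). [cite: Kim2022StructureSelmer, §1.5.1 (PDF p. 7), Thm. 1.10] -/
theorem kuriharaUnitAt_iff_kuriharaPartialInfty_eq_zero [NeZero N] :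
    KuriharaUnitAt W p f ↔ kuriharaPartialInfty W p f = 0 := by
  constructor
  · rintro ⟨n, hn0, hn, hcyc, ψ, hψ, hne⟩
    exact kuriharaPartialInfty_eq_zero_of_ne_zero W p f ⟨hn, hcyc⟩ ψ hψ hne
  · intro h0
    obtain ⟨n, k, hk, hcyc, h1, hk1, ψ, hψ, hne⟩ :=
      exists_certificate_of_kuriharaPartialInfty_le W p f (τ := 0) (by rw [h0]; exact le_rfl)
    obtain rfl : k = 1 := le_antisymm hk1 h1
    exact ⟨n, ⟨hk.ne_zero⟩, hcyc.1, hcyc.2, ψ, hψ, hne⟩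

end Bookkeeping

/-! ### §1 The conjecture items (typed missing inputs; nothing asserted) -/

section Conjecture

/-- **Kim's Conjecture 1.10 at `(E, p)`, the `≤` half — TYPED** (the half the LOWER half of the
`p`-part of BSD needs): `∂^{(∞)}(δ̃) ≤ ∑_{ℓ ∣ N} ord_p c_ℓ`, i.e. SOME cyclic Kolyvagin level carries a
Kurihara number of `p`-divisibility index at most `ord_p ∏_v c_v`. For the collection of Kurihara
numbers of the cusp form `f` (the newform of `W` in every use, `Ω⁺_f`-normalised — Kim's `δ̃` up to
units under the period transfer carried by the consumers). A predicate; nothing asserted; OPEN.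
[cite: Kim2022StructureSelmer, Conj. 1.10 (§1.5.3, PDF p. 8)] -/
@[conjecture] def KimTamagawaDefectLeAt (W : WeierstrassCurve ℚ) [W.IsGloballyMinimal] (p : ℕ)
    {N : ℕ} (f : CuspForm (Gamma0 N) 2) : Prop :=
  kuriharaPartialInfty W p f ≤ (padicValNat p W.tamagawaProduct : ℕ∞)

/-- **Kim's Conjecture 1.10 at `(E, p)`, the `≥` half — TYPED** (the half the TAM-DEFECT rows need;
Büyükboduk 2009's Tamagawa defect of Kato's Euler system, Question 1): EVERY Kurihara number at
EVERY cyclic Kolyvagin level is divisible by `p^{ord_p ∏_v c_v}` in `ℤ_p/I_nℤ_p`. A predicate;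
nothing asserted; OPEN. [cite: Kim2022StructureSelmer, Conj. 1.10 (§1.5.3, PDF p. 8)] -/
@[conjecture] def KimTamagawaDefectGeAt (W : WeierstrassCurve ℚ) [W.IsGloballyMinimal] (p : ℕ)
    {N : ℕ} (f : CuspForm (Gamma0 N) 2) : Prop :=
  (padicValNat p W.tamagawaProduct : ℕ∞) ≤ kuriharaPartialInfty W p f

/-- **Kim's Conjecture 1.10 at `(E, p)` — TYPED**: the Tamagawa defect of the collection of Kurihara
numbers is `∂^{(∞)}(δ̃) = ∑_{ℓ ∣ N} ord_p(c_ℓ) = ord_p ∏_v c_v` (`W.tamagawaProduct`: the product of the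
local Tamagawa numbers over all finite places, `= ∏_{ℓ ∣ N} c_ℓ`). A predicate on `(W, p, f)`;
nothing asserted; OPEN (no proof in print at any additive `p`; at good ordinary `p` a consequence of
the Iwasawa main conjecture). [cite: Kim2022StructureSelmer, Conj. 1.10 (§1.5.3, PDF p. 8)] -/
@[conjecture] def KimTamagawaDefectAt (W : WeierstrassCurve ℚ) [W.IsGloballyMinimal] (p : ℕ)
    {N : ℕ} (f : CuspForm (Gamma0 N) 2) : Prop :=
  kuriharaPartialInfty W p f = (padicValNat p W.tamagawaProduct : ℕ∞)

/-- **Kim 2026, Conjecture 1.10, the printed sentence — TYPED** ("Let `E` be an elliptic curve over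
`ℚ` of conductor `N` and `p ≥ 5` a prime such that `ρ̄` is surjective and the Manin constant is prime
to `p`. Then `∂^{(∞)}(δ̃) = ∑_{ℓ ∣ N} ord_p(c_ℓ)`"), in the binder shape of the tree's Kim-type facts
(globally minimal `W`, `5 ≤ p`, `ρ̄` onto, datum `D` with `p ∤ c_D`, period transfer `Ω(W) = u·Ω⁺_{D.f}`,
`|u|_p = 1`); NO analytic-rank hypothesis (as printed). Nothing asserted; OPEN.
[cite: Kim2022StructureSelmer, Conj. 1.10 (§1.5.3, PDF p. 8)] -/
@[conjecture] def kim2026_conjecture_1_10 : Prop :=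
  ∀ (W : WeierstrassCurve ℚ) [W.IsElliptic] [W.IsGloballyMinimal] (p : ℕ) [Fact p.Prime],
    5 ≤ p → W.HasSurjectiveModNGaloisRep p →
    ∀ {N : ℕ} [NeZero N] (D : ModularParametrizationData W N),
    ¬ (p : ℤ) ∣ D.maninConstant →
    (∃ u : ℚ, ‖(u : ℚ_[p])‖ = 1 ∧ W.realPeriodRat = u * plusPeriod D.f) →
    KimTamagawaDefectAt W p D.f

variable (W : WeierstrassCurve ℚ) [W.IsGloballyMinimal] (p : ℕ) {N : ℕ} (f : CuspForm (Gamma0 N) 2)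

/-- The conjecture is the conjunction of its halves (antisymmetry in `ℕ∞`). Bookkeeping.
[cite: Kim2022StructureSelmer, Conj. 1.10 (§1.5.3, PDF p. 8)] -/
theorem kimTamagawaDefectAt_iff :
    KimTamagawaDefectAt W p f ↔ KimTamagawaDefectLeAt W p f ∧ KimTamagawaDefectGeAt W p f :=
  ⟨fun h => ⟨h.le, h.ge⟩, fun h => le_antisymm h.1 h.2⟩

/-- **On the Tamagawa-prime rows the `≤` half IS additive-p3's `KuriharaUnitAt`** (`p ∤ ∏_v c_v`:
`∂^{(∞)} ≤ 0 ⟺ ∂^{(∞)} = 0 ⟺` a unit mod-`p` Kurihara number at a cyclic level).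
[cite: Kim2022StructureSelmer, Conj. 1.10 and Thm. 1.10 (PDF p. 8)] -/
theorem kimTamagawaDefectLeAt_iff_kuriharaUnitAt_of_not_dvd [NeZero N] [Fact p.Prime]
    (htam : ¬ p ∣ W.tamagawaProduct) : KimTamagawaDefectLeAt W p f ↔ KuriharaUnitAt W p f := by
  rw [kuriharaUnitAt_iff_kuriharaPartialInfty_eq_zero, KimTamagawaDefectLeAt,
    padicValNat.eq_zero_of_not_dvd htam, Nat.cast_zero]
  exact ⟨fun h => nonpos_iff_eq_zero.mp h, fun h => h.le⟩

/-- **On the Tamagawa-prime rows a unit Kurihara number gives the whole conjecture** (`∂^{(∞)} = 0 =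
∑ ord_p c_ℓ`). [cite: Kim2022StructureSelmer, Conj. 1.10 and Thm. 1.10 (PDF p. 8)] -/
theorem kimTamagawaDefectAt_of_kuriharaUnitAt_of_not_dvd [NeZero N] [Fact p.Prime]
    (htam : ¬ p ∣ W.tamagawaProduct) (hK : KuriharaUnitAt W p f) : KimTamagawaDefectAt W p f := by
  rw [KimTamagawaDefectAt, (kuriharaUnitAt_iff_kuriharaPartialInfty_eq_zero W p f).mp hK,
    padicValNat.eq_zero_of_not_dvd htam, Nat.cast_zero]

/-- **On the Tamagawa-divisible rows the `≥` half FORBIDS a unit Kurihara number** (`p ∣ ∏_v c_v`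
and `∂^{(∞)} ≥ ord_p ∏ c_v ≥ 1`, while a unit would force `∂^{(∞)} = 0`) — the conjecture's
explanation of the kernel boundary `X4.not_kuriharaUnitAt_of_bsdp_of_dvd_tamagawaProduct`
(there derived from `BSD(E,p)` instead). [cite: Kim2022StructureSelmer, Conj. 1.10 (PDF p. 8)] -/
theorem not_kuriharaUnitAt_of_kimTamagawaDefectGe_of_dvd [W.IsElliptic] [NeZero N] [Fact p.Prime]
    (htam : p ∣ W.tamagawaProduct) (hge : KimTamagawaDefectGeAt W p f) : ¬ KuriharaUnitAt W p f := by
  intro hK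
  have h0 := (kuriharaUnitAt_iff_kuriharaPartialInfty_eq_zero W p f).mp hK
  have h1 : 1 ≤ padicValNat p W.tamagawaProduct :=
    one_le_padicValNat_of_dvd (W.tamagawaProduct_pos').ne' htam
  have : (1 : ℕ∞) ≤ 0 := by
    calc (1 : ℕ∞) ≤ (padicValNat p W.tamagawaProduct : ℕ∞) := by exact_mod_cast h1
      _ ≤ kuriharaPartialInfty W p f := hge
      _ = 0 := h0
  exact absurd this (by simp)

end Conjecture

/-! ### §2 Consumers in analytic rank `0` at `p ≥ 5`, from PUBLISHED facts -/

section Consumers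

variable (W : WeierstrassCurve ℚ) [W.IsElliptic] [W.IsGloballyMinimal] (p : ℕ) [Fact p.Prime]

/-- **`∂^{(∞)}(δ̃) ≤ τ` bounds `ord_p(L(E,1)/Ω)` by `ord_p #Ш(E)(p) + τ`** — class-agnostic, any
reduction at `p`, from the PUBLISHED level-`p^k` fact `hKimk` (Kim 2026 Thm. 1.9 (6); `p ≥ 5`, `ρ̄`
onto, Manin datum, period transfer, `L(E,1) ≠ 0`, `Ш` finite) at the ONE cyclic level `n ∈ 𝒩_k`,
`k ≤ τ + 1`, that §0 extracts. [cite: Kim2022StructureSelmer, Thm. 1.9 (6) and §1.5.1 (PDF pp. 7–8)] -/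
theorem padicValRat_le_of_kuriharaPartialInfty_le
    (hKimk : Kim2026.rankZero_le_padicValNat_sha_of_kuriharaNumber_ne_zero)
    (hp : 5 ≤ p) (hsurj : W.HasSurjectiveModNGaloisRep p) (hL : W.entireLFunction 1 ≠ 0)
    (hfin : Finite W.sha) {N : ℕ} [NeZero N] (D : ModularParametrizationData W N)
    (hc : ¬ (p : ℤ) ∣ D.maninConstant)
    (hper : ∃ u : ℚ, ‖(u : ℚ_[p])‖ = 1 ∧ W.realPeriodRat = u * plusPeriod D.f)
    {τ : ℕ} (hτ : kuriharaPartialInfty W p D.f ≤ τ) :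
    ∃ q : ℚ, W.entireLFunction 1 / (W.realPeriodRat : ℂ) = (q : ℂ) ∧
      padicValRat p q ≤ (padicValNat p (Nat.card (AddCommGroup.primaryComponent W.sha p)) : ℤ) + τ := by
  obtain ⟨n, k, hk, hcyc, h1, hkτ, ψ, hψ, hne⟩ :=
    exists_certificate_of_kuriharaPartialInfty_le W p D.f hτ
  haveI : NeZero n := ⟨hk.ne_zero⟩
  obtain ⟨q, hq, hle⟩ := hKimk W p hp hsurj hL hfin D hc hper k n h1 hk hcyc.2 ψ hψ hne
  refine ⟨q, hq, hle.trans ?_⟩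
  have : ((k - 1 : ℕ) : ℤ) ≤ (τ : ℤ) := by omega
  linarith

/-- **The LOWER half of the `p`-part of BSD from the `≤` half of Kim's Conjecture 1.10** — analytic
rank `0`, `p ≥ 5`, `ρ̄_{E,p}` onto, Manin datum `D` with the period transfer, ANY reduction at `p`:
`KimTamagawaDefectLeAt W p D.f ⟹ Typed.MissingLowerBoundAt W p`. Inputs: PUBLISHED `hKimk`,
Gross–Zagier–Kolyvagin `hGZK`, modularity `hmod`; torsion prime to `p` since `ρ̄` is onto. Reading:
`#Ш_an = (L(E,1)/Ω)·#tors²/∏c`, so `ord_p #Ш_an = ord_p q − ord_p ∏c ≤ ord_p #Ш`. NOT a class theorem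
(the hypothesis is the conjecture): it NAMES the class-level input of N10's X4 ∧ surj rows at `p ≥ 5`.
[cite: Kim2022StructureSelmer, Thm. 1.9 (6) and Conj. 1.10 (PDF p. 8)] [cite: Miller2011LMS, Def. 1.1] -/
theorem missingLowerBoundAt_of_kimTamagawaDefectLe
    (hKimk : Kim2026.rankZero_le_padicValNat_sha_of_kuriharaNumber_ne_zero)
    (hGZK : rank_eq_analyticRank_of_analyticRank_le_one) (hmod : hasEntireLFunction_rat)
    (hp : 5 ≤ p) (hr : W.analyticRank = 0) (hsurj : W.HasSurjectiveModNGaloisRep p)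
    {N : ℕ} [NeZero N] (D : ModularParametrizationData W N) (hc : ¬ (p : ℤ) ∣ D.maninConstant)
    (hper : ∃ u : ℚ, ‖(u : ℚ_[p])‖ = 1 ∧ W.realPeriodRat = u * plusPeriod D.f)
    (hle : KimTamagawaDefectLeAt W p D.f) : MissingLowerBoundAt W p := by
  have hL : W.entireLFunction 1 ≠ 0 := (W.analyticRank_eq_zero_iff_holds (hmod W)).mp hr
  obtain ⟨hmw, hfin⟩ := hGZK W (by rw [hr]; exact zero_le_one)
  haveI : Finite W.sha := hfin
  have hmw0 : W.mordellWeilRank = 0 := by rw [hmw, hr]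
  obtain ⟨q₀, hq₀, hle₀⟩ :=
    padicValRat_le_of_kuriharaPartialInfty_le W p hKimk hp hsurj hL hfin D hc hper hle
  -- positivity of the BSD denominators
  have hΩpos : 0 < W.realPeriodRat := W.realPeriodRat_pos_holds
  have hΩ : (W.realPeriodRat : ℂ) ≠ 0 := by exact_mod_cast hΩpos.ne'
  have hc0 : 0 < W.tamagawaProduct := W.tamagawaProduct_pos'
  have ht0 : 0 < W.torsionOrder := W.torsionOrder_pos_holds
  have hq₀0 : q₀ ≠ 0 := by
    rintro rfl
    rw [Rat.cast_zero, div_eq_zero_iff] at hq₀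
    exact hq₀.elim hL hΩ
  refine ⟨q₀ * (W.torsionOrder : ℚ) ^ 2 / (W.tamagawaProduct : ℚ), ?_, ?_⟩
  · -- `#Ш_an = (L(E,1)/Ω) · #tors² / ∏ c_ℓ` in analytic rank `0`
    have hcp : (W.tamagawaProduct : ℂ) ≠ 0 := by exact_mod_cast hc0.ne'
    have hLq : W.entireLFunction 1 = (q₀ : ℂ) * (W.realPeriodRat : ℂ) := by
      rw [← hq₀, div_mul_cancel₀ _ hΩ]
    rw [shaAn_def, leadingLCoeff_eq_of_analyticRank_eq_zero W hr,
      W.regulator_eq_one_of_rank_zero hmw0, hLq]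
    push_cast
    field_simp
  · -- valuations: `ord_p(q₀·#tors²/∏c) = ord_p q₀ − ord_p ∏c ≤ ord_p #Ш(p) = ord_p #Ш`
    have ht : (W.torsionOrder : ℚ) ≠ 0 := by exact_mod_cast ht0.ne'
    have hcq : (W.tamagawaProduct : ℚ) ≠ 0 := by exact_mod_cast hc0.ne'
    have hsha : padicValNat p (Nat.card (AddCommGroup.primaryComponent W.sha p)) =
        padicValNat p W.shaOrder := by
      unfold WeierstrassCurve.shaOrder
      exact padicValNat_card_addPrimaryComponent p
    have htors0 : padicValNat p W.torsionOrder = 0 :=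
      padicValNat_torsionOrder_eq_zero_of_irreducible W p
        (hasIrreducibleModPGaloisRep_of_hasSurjectiveModNGaloisRep W p hsurj)
    have hv : padicValRat p (q₀ * (W.torsionOrder : ℚ) ^ 2 / (W.tamagawaProduct : ℚ)) =
        padicValRat p q₀ + 2 * (padicValNat p W.torsionOrder : ℤ) -
          (padicValNat p W.tamagawaProduct : ℤ) := by
      rw [padicValRat.div (mul_ne_zero hq₀0 (pow_ne_zero 2 ht)) hcq,
        padicValRat.mul hq₀0 (pow_ne_zero 2 ht), pow_two, padicValRat.mul ht ht,
        padicValRat.of_nat, padicValRat.of_nat]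
      ring
    rw [hv, htors0, ← hsha]
    simp only [Nat.cast_zero, mul_zero, add_zero]
    linarith

/-- **Both halves of the `p`-part from the `≤` half of Conj. 1.10 and ANY typed upper half**
(`Typed.MissingUpperBoundAt W p`: the Kato / Kim / Delbourgo upper-half theorems of the cell on their
rows). [cite: Kim2022StructureSelmer, Thm. 1.9 (6) and Conj. 1.10 (PDF p. 8)] [cite: Miller2011LMS, Def. 1.1] -/
theorem missingPPartAt_of_kimTamagawaDefectLe_of_upper
    (hKimk : Kim2026.rankZero_le_padicValNat_sha_of_kuriharaNumber_ne_zero)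
    (hGZK : rank_eq_analyticRank_of_analyticRank_le_one) (hmod : hasEntireLFunction_rat)
    (hp : 5 ≤ p) (hr : W.analyticRank = 0) (hsurj : W.HasSurjectiveModNGaloisRep p)
    {N : ℕ} [NeZero N] (D : ModularParametrizationData W N) (hc : ¬ (p : ℤ) ∣ D.maninConstant)
    (hper : ∃ u : ℚ, ‖(u : ℚ_[p])‖ = 1 ∧ W.realPeriodRat = u * plusPeriod D.f)
    (hle : KimTamagawaDefectLeAt W p D.f) (hub : MissingUpperBoundAt W p) : MissingPPartAt W p :=
  missingPPartAt_of_lower_of_upper W p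
    (missingLowerBoundAt_of_kimTamagawaDefectLe W p hKimk hGZK hmod hp hr hsurj D hc hper hle) hub

/-- **`BSD(E,p)` in analytic rank `0` from the `≤` half of Conj. 1.10 and any typed upper half.**
[cite: Kim2022StructureSelmer, Thm. 1.9 (6) and Conj. 1.10 (PDF p. 8)] [cite: Miller2011LMS, §1 and Def. 1.1] -/
theorem bsdp_of_kimTamagawaDefectLe_of_upper
    (hKimk : Kim2026.rankZero_le_padicValNat_sha_of_kuriharaNumber_ne_zero)
    (hGZK : rank_eq_analyticRank_of_analyticRank_le_one) (hmod : hasEntireLFunction_rat)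
    (hp : 5 ≤ p) (hr : W.analyticRank = 0) (hsurj : W.HasSurjectiveModNGaloisRep p)
    {N : ℕ} [NeZero N] (D : ModularParametrizationData W N) (hc : ¬ (p : ℤ) ∣ D.maninConstant)
    (hper : ∃ u : ℚ, ‖(u : ℚ_[p])‖ = 1 ∧ W.realPeriodRat = u * plusPeriod D.f)
    (hle : KimTamagawaDefectLeAt W p D.f) (hub : MissingUpperBoundAt W p) : BSDp W p :=
  bsdp_of_missingPPartAt W p hGZK (by rw [hr]; exact zero_le_one)
    (missingPPartAt_of_kimTamagawaDefectLe_of_upper W p hKimk hGZK hmod hp hr hsurj D hc hper hle hub)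

/-- **X4 ∧ `r_an = 0` ∧ `p ≥ 5` ∧ `ρ̄` onto ∧ Manin ∧ `p ∤ ∏ c_ℓ`: `BSD(E,p)` from the `≤` half
ALONE** — the upper half being Kim's PUBLISHED bound (`hKim`, `Additive.X4RankZero.missingUpperBoundAt`)
and the `≤` half a unit Kurihara number (`kimTamagawaDefectLeAt_iff_kuriharaUnitAt_of_not_dvd`): the
Kurihara route re-derived through the conjecture. NOT a class theorem.
[cite: Kim2022StructureSelmer, Thm. 1.9 (6), Thm. 1.10 and Conj. 1.10 (PDF p. 8)] [cite: Miller2011LMS, Def. 1.1] -/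
theorem bsdp_of_kimTamagawaDefectLe_of_not_dvd_tamagawaProduct
    (hKimk : Kim2026.rankZero_le_padicValNat_sha_of_kuriharaNumber_ne_zero)
    (hKim : Kim2026.rankZero_padicValNat_sha_le_of_maninConstant)
    (hGZK : rank_eq_analyticRank_of_analyticRank_le_one) (hmod : hasEntireLFunction_rat)
    (hp : 5 ≤ p) (hr : W.analyticRank = 0) (hX : ClassX4 W p) (hsurj : Surj W p)
    {N : ℕ} [NeZero N] (D : ModularParametrizationData W N) (hc : ¬ (p : ℤ) ∣ D.maninConstant)
    (hper : ∃ u : ℚ, ‖(u : ℚ_[p])‖ = 1 ∧ W.realPeriodRat = u * plusPeriod D.f)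
    (htam : ¬ p ∣ W.tamagawaProduct) (hle : KimTamagawaDefectLeAt W p D.f) : BSDp W p :=
  bsdp_of_kimTamagawaDefectLe_of_upper W p hKimk hGZK hmod hp hr hsurj D hc hper hle
    (Additive.X4RankZero.missingUpperBoundAt W p hKim hGZK hmod hp hr hX hsurj D hc htam)

/-- **The printed conjecture closes the LOWER half on every X4 ∧ surj ∧ `r_an = 0` pair at `p ≥ 5`
with a Manin datum** (`kim2026_conjecture_1_10` the ONE hypothesis beyond PUBLISHED facts); with the
cell's upper-half theorems, N10's residue on these rows (LOWER and TAM-DEFECT alike) IS Kim's Conj. 1.10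
— OPEN; label X4 UNCHANGED. [cite: Kim2022StructureSelmer, Conj. 1.10 (PDF p. 8)] [cite: Miller2011LMS, Def. 1.1] -/
theorem missingLowerBoundAt_of_kim2026Conjecture
    (hconj : kim2026_conjecture_1_10)
    (hKimk : Kim2026.rankZero_le_padicValNat_sha_of_kuriharaNumber_ne_zero)
    (hGZK : rank_eq_analyticRank_of_analyticRank_le_one) (hmod : hasEntireLFunction_rat)
    (hp : 5 ≤ p) (hr : W.analyticRank = 0) (_hX : ClassX4 W p) (hsurj : Surj W p)
    {N : ℕ} [NeZero N] (D : ModularParametrizationData W N) (hc : ¬ (p : ℤ) ∣ D.maninConstant)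
    (hper : ∃ u : ℚ, ‖(u : ℚ_[p])‖ = 1 ∧ W.realPeriodRat = u * plusPeriod D.f) :
    MissingLowerBoundAt W p :=
  missingLowerBoundAt_of_kimTamagawaDefectLe W p hKimk hGZK hmod hp hr hsurj D hc hper
    ((kimTamagawaDefectAt_iff W p D.f).mp (hconj W p hp hsurj D hc hper)).1

end Consumers

end Summit.BirchSwinnertonDyer.Rank1Residual.X4
end
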